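import Mathlib
import Summits.ResolutionOfSingularities.ResolutionOfSingularities.Theorems.HomologicalConductorPersistenceSurfaceSaturationResidualFourReduction
import Summits.ResolutionOfSingularities.ResolutionOfSingularities.Theorems.HomologicalConductorPersistenceSurfaceSaturationGorenstein
import HarnessLib

/-!
# Rung S-2 `PersistenceSurface` (stmt-ResolutionOfSingularities-19970) — the Sat₄ residual with the GORENSTEIN
# EXEMPTION: `SaturationFourSurfaceResidual₄` ⇐ «stage 0» ∧ «`Sat₄` (or `(SC₃)`) at the NON-Gorenstein normal stages»

Route `ResolutionOfSingularities/HomologicalConductor`, chain W4.4b, rung S-2 `PersistenceSurface`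
(stmt-ResolutionOfSingularities-19970), registered skeleton 1a77c002, stub
`stub_saturationFourSurfaceResidualFour : SaturationFourSurfaceResidual₄`.  [OURS · bookkeeping over LANDED tree
lemmas; AI-written, weaker than expert review; NOT a statement of the manuscript under study (Hironaka 2017).]
DEF-FREE: no new `def`, no conjecture; hypotheses spelled inline.

Composition of the two helpers `…SaturationResidualFourReduction` (split «stage 0 / integrally closed stages»,
`(SC₃)` reading) and `…SaturationGorenstein` (`Sat₃` at every stage `↥T` with `Extⁱ_{↥T}(W, ↥T) = 0` for all finitely
generated `W` and all `i ≥ 3` — «Gorenstein of dimension `≤ 2`»):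

* `saturationFourSurfaceResidual₄_of_stageZero_of_nonGorenstein` — the fourth residual follows from
  (0) `Sat₄` at stage `0` (`T_0 = loc A`, possibly non-normal) under the residual clauses, and
  (NG) `Sat₄` at every INTEGRALLY CLOSED residual stage `↥(tower O A m)` which is NOT Gorenstein in the above sense
  (`¬ ∀ W f.g., ∀ i ≥ 3, Extⁱ(W, T_m) = 0`); the Gorenstein integrally closed stages are discharged by
  `PersistenceSurfaceSaturationGorenstein.ca_subset_caAt_four_of_ext_eq_zero` (excluded middle glues);
* `saturationFourSurfaceResidual₄_of_stageZero_of_nonGorenstein_isSyzygy_three_retract` — the same with (NG) in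
  syzygy currency: `(SC₃)` (every third syzygy module a retract of a fourth syzygy module) at the non-Gorenstein
  integrally closed residual stages.

NET CONTENT of the stub after this file: `Sat₄` at a non-normal two-dimensional stage `0` with a singular successor, and
`Sat₄` / `(SC₃)` at the two-dimensional NORMAL NON-GORENSTEIN stages (not monic-hypersurface localisations, not
edim-candidates, successor singular) — kernel-certified so far only for the cyclic quotients `k[u,v]^{1/n(1,q)}`
(`…PersistenceCyclicQuotientCharFreeHerzog`).  Nothing is asserted about these classes here.

References (mechanism only): W. Bruns, J. Herzog, *Cohen–Macaulay rings*, rev. ed. 1998, Thm. 3.3.10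
[`BrunsHerzog1998`]; S. B. Iyengar, R. Takahashi, IMRN 2016, §2 [`IyengarTakahashi2014`].
-/

noncomputable section

-- single-problem summit: the doubled namespace component `ResolutionOfSingularities` is forced
set_option linter.dupNamespace false

namespace Summit.ResolutionOfSingularities.ResolutionOfSingularities.Theorems.HomologicalConductor.PersistenceSurfaceSaturationResidualFourGorenstein

open CategoryTheory CategoryTheory.Abelian Literature.RingTheory.CohomologyAnnihilator
open Summit.ResolutionOfSingularities.ResolutionOfSingularities.Theorems
open Summit.ResolutionOfSingularities.ResolutionOfSingularities.Theorems.NoZeno.Birth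
open Summit.ResolutionOfSingularities.ResolutionOfSingularities.Theorems.HomologicalConductor.PersistenceSurfaceSaturationResidual
open Summit.ResolutionOfSingularities.ResolutionOfSingularities.Theorems.HomologicalConductor.PersistenceSurfaceSaturationResidualThree
open Summit.ResolutionOfSingularities.ResolutionOfSingularities.Theorems.HomologicalConductor.PersistenceSurfaceSaturationResidualFour
open Summit.ResolutionOfSingularities.ResolutionOfSingularities.Theorems.HomologicalConductor.PersistenceSurfaceSaturationResidualFourReduction
open Summit.ResolutionOfSingularities.ResolutionOfSingularities.Theorems.HomologicalConductor.PersistenceSurfaceSaturationGorenstein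

/-- **The fourth residual with the Gorenstein exemption.**  `SaturationFourSurfaceResidual₄` follows from
(0) `Sat₄` at stage `0` under the residual clauses, and (NG) `Sat₄` at every integrally closed residual stage
`↥(tower O A m)` that is NOT Gorenstein in the sense `∀ W f.g., ∀ i ≥ 3, Extⁱ(W, ↥(tower O A m)) = 0`; at the Gorenstein
integrally closed stages `Sat₄` holds by `PersistenceSurfaceSaturationGorenstein.ca_subset_caAt_four_of_ext_eq_zero`
(the stage is a noetherian domain: `NoZeno.Birth.stub_towerNoetherian`, subalgebra of a field).
[cite: BrunsHerzog1998, Thm. 3.3.10; IyengarTakahashi2014, §2] -/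
theorem saturationFourSurfaceResidual₄_of_stageZero_of_nonGorenstein
    (h0 : ∀ p : ℕ, p.Prime → ∀ (k K : Type) [Field k] [CharP k p] [Field K] [Algebra k K]
      (O : ValuationSubring K) (A : Subalgebra k K), (∀ c : k, algebraMap k K c ∈ O) → A.FG →
      IsFractionRing ↥A K → A.toSubring ≤ O.toSubring → ringKrullDim ↥A ≤ 2 →
      ¬ IsRegularLocalRing ↥(tower O A 0) → ¬ IsMonicHypersurfaceLocalization k 2 ↥(tower O A 0) →
      ¬ IsEdimHypersurfaceCandidate 2 ↥(tower O A 0) → ¬ IsRegularLocalRing ↥(tower O A 1) →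
      ringKrullDim ↥(tower O A 0) = (2 : ℕ) →
      {x : K | ∃ hx : x ∈ tower O A 0, ∃ n : ℕ, ∀ i : ℕ, n ≤ i → ∀ (M N : ModuleCat.{0} ↥(tower O A 0)),
          Module.Finite ↥(tower O A 0) M → Module.Finite ↥(tower O A 0) N →
            ∀ e : CategoryTheory.Abelian.Ext.{0} M N i, (⟨x, hx⟩ : ↥(tower O A 0)) • e = 0} ⊆
        {x : K | ∃ hx : x ∈ tower O A 0, ∀ i : ℕ, 4 ≤ i → ∀ (M N : ModuleCat.{0} ↥(tower O A 0)),
          Module.Finite ↥(tower O A 0) M → Module.Finite ↥(tower O A 0) N →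
            ∀ e : CategoryTheory.Abelian.Ext.{0} M N i, (⟨x, hx⟩ : ↥(tower O A 0)) • e = 0})
    (hNG : ∀ p : ℕ, p.Prime → ∀ (k K : Type) [Field k] [CharP k p] [Field K] [Algebra k K]
      (O : ValuationSubring K) (A : Subalgebra k K), (∀ c : k, algebraMap k K c ∈ O) → A.FG →
      IsFractionRing ↥A K → A.toSubring ≤ O.toSubring → ringKrullDim ↥A ≤ 2 → ∀ m : ℕ,
      IsIntegrallyClosed ↥(tower O A m) →
      ¬ (∀ (W : ModuleCat.{0} ↥(tower O A m)), Module.Finite ↥(tower O A m) W → ∀ i : ℕ, 3 ≤ i →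
          ∀ e : CategoryTheory.Abelian.Ext.{0} W (ModuleCat.of ↥(tower O A m) ↥(tower O A m)) i, e = 0) →
      ¬ IsRegularLocalRing ↥(tower O A m) → ¬ IsMonicHypersurfaceLocalization k 2 ↥(tower O A m) →
      ¬ IsEdimHypersurfaceCandidate 2 ↥(tower O A m) → ¬ IsRegularLocalRing ↥(tower O A (m + 1)) →
      ringKrullDim ↥(tower O A m) = (2 : ℕ) →
      {x : K | ∃ hx : x ∈ tower O A m, ∃ n : ℕ, ∀ i : ℕ, n ≤ i → ∀ (M N : ModuleCat.{0} ↥(tower O A m)),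
          Module.Finite ↥(tower O A m) M → Module.Finite ↥(tower O A m) N →
            ∀ e : CategoryTheory.Abelian.Ext.{0} M N i, (⟨x, hx⟩ : ↥(tower O A m)) • e = 0} ⊆
        {x : K | ∃ hx : x ∈ tower O A m, ∀ i : ℕ, 4 ≤ i → ∀ (M N : ModuleCat.{0} ↥(tower O A m)),
          Module.Finite ↥(tower O A m) M → Module.Finite ↥(tower O A m) N →
            ∀ e : CategoryTheory.Abelian.Ext.{0} M N i, (⟨x, hx⟩ : ↥(tower O A m)) • e = 0}) :
    SaturationFourSurfaceResidual₄ := by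
  refine saturationFourSurfaceResidual₄_of_stageZero_of_isIntegrallyClosed h0 ?_
  intro p hp k K _ _ _ _ O A hk hA hfr hAO hdim m hnorm hreg hmon hcand hsucc hdim2
  haveI : IsNoetherianRing ↥(tower O A m) := stub_towerNoetherian k K O A hk hA hfr hAO m
  by_cases hGor : ∀ (W : ModuleCat.{0} ↥(tower O A m)), Module.Finite ↥(tower O A m) W → ∀ i : ℕ, 3 ≤ i →
      ∀ e : CategoryTheory.Abelian.Ext.{0} W (ModuleCat.of ↥(tower O A m) ↥(tower O A m)) i, e = 0
  · exact ca_subset_caAt_four_of_ext_eq_zero (tower O A m) hGor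
  · exact hNG p hp k K O A hk hA hfr hAO hdim m hnorm hGor hreg hmon hcand hsucc hdim2

/-- **The fourth residual with the Gorenstein exemption, syzygy currency.**  `SaturationFourSurfaceResidual₄`
follows from (0) `Sat₄` at stage `0` under the residual clauses and (NG′) the retract property `(SC₃)` — every third
syzygy module of a finitely generated module is a retract of a fourth syzygy module of a finitely generated module —
over every integrally closed, NON-Gorenstein residual stage `↥(tower O A m)`.
[cite: BrunsHerzog1998, Thm. 3.3.10; IyengarTakahashi2014, §2] -/
theorem saturationFourSurfaceResidual₄_of_stageZero_of_nonGorenstein_isSyzygy_three_retract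
    (h0 : ∀ p : ℕ, p.Prime → ∀ (k K : Type) [Field k] [CharP k p] [Field K] [Algebra k K]
      (O : ValuationSubring K) (A : Subalgebra k K), (∀ c : k, algebraMap k K c ∈ O) → A.FG →
      IsFractionRing ↥A K → A.toSubring ≤ O.toSubring → ringKrullDim ↥A ≤ 2 →
      ¬ IsRegularLocalRing ↥(tower O A 0) → ¬ IsMonicHypersurfaceLocalization k 2 ↥(tower O A 0) →
      ¬ IsEdimHypersurfaceCandidate 2 ↥(tower O A 0) → ¬ IsRegularLocalRing ↥(tower O A 1) →
      ringKrullDim ↥(tower O A 0) = (2 : ℕ) →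
      {x : K | ∃ hx : x ∈ tower O A 0, ∃ n : ℕ, ∀ i : ℕ, n ≤ i → ∀ (M N : ModuleCat.{0} ↥(tower O A 0)),
          Module.Finite ↥(tower O A 0) M → Module.Finite ↥(tower O A 0) N →
            ∀ e : CategoryTheory.Abelian.Ext.{0} M N i, (⟨x, hx⟩ : ↥(tower O A 0)) • e = 0} ⊆
        {x : K | ∃ hx : x ∈ tower O A 0, ∀ i : ℕ, 4 ≤ i → ∀ (M N : ModuleCat.{0} ↥(tower O A 0)),
          Module.Finite ↥(tower O A 0) M → Module.Finite ↥(tower O A 0) N →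
            ∀ e : CategoryTheory.Abelian.Ext.{0} M N i, (⟨x, hx⟩ : ↥(tower O A 0)) • e = 0})
    (hNG : ∀ p : ℕ, p.Prime → ∀ (k K : Type) [Field k] [CharP k p] [Field K] [Algebra k K]
      (O : ValuationSubring K) (A : Subalgebra k K), (∀ c : k, algebraMap k K c ∈ O) → A.FG →
      IsFractionRing ↥A K → A.toSubring ≤ O.toSubring → ringKrullDim ↥A ≤ 2 → ∀ m : ℕ,
      IsIntegrallyClosed ↥(tower O A m) →
      ¬ (∀ (W : ModuleCat.{0} ↥(tower O A m)), Module.Finite ↥(tower O A m) W → ∀ i : ℕ, 3 ≤ i →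
          ∀ e : CategoryTheory.Abelian.Ext.{0} W (ModuleCat.of ↥(tower O A m) ↥(tower O A m)) i, e = 0) →
      ¬ IsRegularLocalRing ↥(tower O A m) → ¬ IsMonicHypersurfaceLocalization k 2 ↥(tower O A m) →
      ¬ IsEdimHypersurfaceCandidate 2 ↥(tower O A m) → ¬ IsRegularLocalRing ↥(tower O A (m + 1)) →
      ringKrullDim ↥(tower O A m) = (2 : ℕ) →
      ∀ (M N : ModuleCat.{0} ↥(tower O A m)), Module.Finite ↥(tower O A m) M → IsSyzygy 3 M N →
        ∃ (M' N' : ModuleCat.{0} ↥(tower O A m)) (i : N ⟶ N') (r : N' ⟶ N),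
          Module.Finite ↥(tower O A m) M' ∧ IsSyzygy 4 M' N' ∧ i ≫ r = 𝟙 N) :
    SaturationFourSurfaceResidual₄ := by
  refine saturationFourSurfaceResidual₄_of_stageZero_of_nonGorenstein h0 ?_
  intro p hp k K _ _ _ _ O A hk hA hfr hAO hdim m hnorm hGor hreg hmon hcand hsucc hdim2
  haveI : IsNoetherianRing ↥(tower O A m) := stub_towerNoetherian k K O A hk hA hfr hAO m
  exact ca_subset_caAt_of_forall_isSyzygy_retract_at (tower O A m) 3
    (hNG p hp k K O A hk hA hfr hAO hdim m hnorm hGor hreg hmon hcand hsucc hdim2) le_rfl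

/-! ## The Gorenstein exemption at EVERY stage, stage `0` included (appended) -/

/-- **The fourth residual from `Sat₄` at the NON-Gorenstein residual stages only.**  The Gorenstein theorem
`PersistenceSurfaceSaturationGorenstein.ca_subset_caAt_four_of_ext_eq_zero` needs the stage to be a noetherian DOMAIN,
not a normal one, so it also exempts a Gorenstein NON-normal stage `0`: `SaturationFourSurfaceResidual₄` follows from
`Sat₄` at every stage `↥(tower O A m)` (any `m`, stage `0` included) that satisfies the residual clauses and is NOT
Gorenstein in the sense `∀ W f.g., ∀ i ≥ 3, Extⁱ(W, ↥(tower O A m)) = 0`.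
[cite: BrunsHerzog1998, Thm. 3.3.10; IyengarTakahashi2014, §2] -/
theorem saturationFourSurfaceResidual₄_of_nonGorenstein
    (hNG : ∀ p : ℕ, p.Prime → ∀ (k K : Type) [Field k] [CharP k p] [Field K] [Algebra k K]
      (O : ValuationSubring K) (A : Subalgebra k K), (∀ c : k, algebraMap k K c ∈ O) → A.FG →
      IsFractionRing ↥A K → A.toSubring ≤ O.toSubring → ringKrullDim ↥A ≤ 2 → ∀ m : ℕ,
      ¬ (∀ (W : ModuleCat.{0} ↥(tower O A m)), Module.Finite ↥(tower O A m) W → ∀ i : ℕ, 3 ≤ i →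
          ∀ e : CategoryTheory.Abelian.Ext.{0} W (ModuleCat.of ↥(tower O A m) ↥(tower O A m)) i, e = 0) →
      ¬ IsRegularLocalRing ↥(tower O A m) → ¬ IsMonicHypersurfaceLocalization k 2 ↥(tower O A m) →
      ¬ IsEdimHypersurfaceCandidate 2 ↥(tower O A m) → ¬ IsRegularLocalRing ↥(tower O A (m + 1)) →
      ringKrullDim ↥(tower O A m) = (2 : ℕ) →
      {x : K | ∃ hx : x ∈ tower O A m, ∃ n : ℕ, ∀ i : ℕ, n ≤ i → ∀ (M N : ModuleCat.{0} ↥(tower O A m)),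
          Module.Finite ↥(tower O A m) M → Module.Finite ↥(tower O A m) N →
            ∀ e : CategoryTheory.Abelian.Ext.{0} M N i, (⟨x, hx⟩ : ↥(tower O A m)) • e = 0} ⊆
        {x : K | ∃ hx : x ∈ tower O A m, ∀ i : ℕ, 4 ≤ i → ∀ (M N : ModuleCat.{0} ↥(tower O A m)),
          Module.Finite ↥(tower O A m) M → Module.Finite ↥(tower O A m) N →
            ∀ e : CategoryTheory.Abelian.Ext.{0} M N i, (⟨x, hx⟩ : ↥(tower O A m)) • e = 0}) :
    SaturationFourSurfaceResidual₄ := by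
  intro p hp k K _ _ _ _ O A hk hA hfr hAO hdim caAt ca loc chart nrm tower m hreg hmon hcand hsucc hdim2
  haveI : IsNoetherianRing ↥(NoZeno.Birth.tower O A m) := stub_towerNoetherian k K O A hk hA hfr hAO m
  by_cases hGor : ∀ (W : ModuleCat.{0} ↥(NoZeno.Birth.tower O A m)),
      Module.Finite ↥(NoZeno.Birth.tower O A m) W → ∀ i : ℕ, 3 ≤ i →
        ∀ e : CategoryTheory.Abelian.Ext.{0} W
          (ModuleCat.of ↥(NoZeno.Birth.tower O A m) ↥(NoZeno.Birth.tower O A m)) i, e = 0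
  · exact ca_subset_caAt_four_of_ext_eq_zero (NoZeno.Birth.tower O A m) hGor
  · exact hNG p hp k K O A hk hA hfr hAO hdim m hGor hreg hmon hcand hsucc hdim2

/-- **The fourth residual from the NON-Gorenstein stages, split «stage 0 / integrally closed stages».**
`SaturationFourSurfaceResidual₄` follows from (0′) `Sat₄` at a NON-Gorenstein stage `0` under the residual clauses and
(NG) `Sat₄` at every integrally closed NON-Gorenstein residual stage.  NET CONTENT of the stub: `Sat₄` at the
two-dimensional NON-Gorenstein stages with a singular successor, outside the monic-hypersurface / edim-candidate classes
— stage `0` possibly non-normal, every later stage normal. [cite: BrunsHerzog1998, Thm. 3.3.10; IyengarTakahashi2014, §2] -/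
theorem saturationFourSurfaceResidual₄_of_stageZero_nonGorenstein_of_nonGorenstein_isIntegrallyClosed
    (h0 : ∀ p : ℕ, p.Prime → ∀ (k K : Type) [Field k] [CharP k p] [Field K] [Algebra k K]
      (O : ValuationSubring K) (A : Subalgebra k K), (∀ c : k, algebraMap k K c ∈ O) → A.FG →
      IsFractionRing ↥A K → A.toSubring ≤ O.toSubring → ringKrullDim ↥A ≤ 2 →
      ¬ (∀ (W : ModuleCat.{0} ↥(tower O A 0)), Module.Finite ↥(tower O A 0) W → ∀ i : ℕ, 3 ≤ i →
          ∀ e : CategoryTheory.Abelian.Ext.{0} W (ModuleCat.of ↥(tower O A 0) ↥(tower O A 0)) i, e = 0) →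
      ¬ IsRegularLocalRing ↥(tower O A 0) → ¬ IsMonicHypersurfaceLocalization k 2 ↥(tower O A 0) →
      ¬ IsEdimHypersurfaceCandidate 2 ↥(tower O A 0) → ¬ IsRegularLocalRing ↥(tower O A 1) →
      ringKrullDim ↥(tower O A 0) = (2 : ℕ) →
      {x : K | ∃ hx : x ∈ tower O A 0, ∃ n : ℕ, ∀ i : ℕ, n ≤ i → ∀ (M N : ModuleCat.{0} ↥(tower O A 0)),
          Module.Finite ↥(tower O A 0) M → Module.Finite ↥(tower O A 0) N →
            ∀ e : CategoryTheory.Abelian.Ext.{0} M N i, (⟨x, hx⟩ : ↥(tower O A 0)) • e = 0} ⊆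
        {x : K | ∃ hx : x ∈ tower O A 0, ∀ i : ℕ, 4 ≤ i → ∀ (M N : ModuleCat.{0} ↥(tower O A 0)),
          Module.Finite ↥(tower O A 0) M → Module.Finite ↥(tower O A 0) N →
            ∀ e : CategoryTheory.Abelian.Ext.{0} M N i, (⟨x, hx⟩ : ↥(tower O A 0)) • e = 0})
    (hNG : ∀ p : ℕ, p.Prime → ∀ (k K : Type) [Field k] [CharP k p] [Field K] [Algebra k K]
      (O : ValuationSubring K) (A : Subalgebra k K), (∀ c : k, algebraMap k K c ∈ O) → A.FG →
      IsFractionRing ↥A K → A.toSubring ≤ O.toSubring → ringKrullDim ↥A ≤ 2 → ∀ m : ℕ,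
      IsIntegrallyClosed ↥(tower O A m) →
      ¬ (∀ (W : ModuleCat.{0} ↥(tower O A m)), Module.Finite ↥(tower O A m) W → ∀ i : ℕ, 3 ≤ i →
          ∀ e : CategoryTheory.Abelian.Ext.{0} W (ModuleCat.of ↥(tower O A m) ↥(tower O A m)) i, e = 0) →
      ¬ IsRegularLocalRing ↥(tower O A m) → ¬ IsMonicHypersurfaceLocalization k 2 ↥(tower O A m) →
      ¬ IsEdimHypersurfaceCandidate 2 ↥(tower O A m) → ¬ IsRegularLocalRing ↥(tower O A (m + 1)) →
      ringKrullDim ↥(tower O A m) = (2 : ℕ) →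
      {x : K | ∃ hx : x ∈ tower O A m, ∃ n : ℕ, ∀ i : ℕ, n ≤ i → ∀ (M N : ModuleCat.{0} ↥(tower O A m)),
          Module.Finite ↥(tower O A m) M → Module.Finite ↥(tower O A m) N →
            ∀ e : CategoryTheory.Abelian.Ext.{0} M N i, (⟨x, hx⟩ : ↥(tower O A m)) • e = 0} ⊆
        {x : K | ∃ hx : x ∈ tower O A m, ∀ i : ℕ, 4 ≤ i → ∀ (M N : ModuleCat.{0} ↥(tower O A m)),
          Module.Finite ↥(tower O A m) M → Module.Finite ↥(tower O A m) N →
            ∀ e : CategoryTheory.Abelian.Ext.{0} M N i, (⟨x, hx⟩ : ↥(tower O A m)) • e = 0}) :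
    SaturationFourSurfaceResidual₄ := by
  refine saturationFourSurfaceResidual₄_of_nonGorenstein ?_
  intro p hp k K _ _ _ _ O A hk hA hfr hAO hdim m hGor hreg hmon hcand hsucc hdim2
  cases m with
  | zero => exact h0 p hp k K O A hk hA hfr hAO hdim hGor hreg hmon hcand hsucc hdim2
  | succ n =>
    exact hNG p hp k K O A hk hA hfr hAO hdim (n + 1) (d2rc_isIntegrallyClosed_tower_succ O A hk hA hfr hAO n)
      hGor hreg hmon hcand hsucc hdim2

end Summit.ResolutionOfSingularities.ResolutionOfSingularities.Theorems.HomologicalConductor.PersistenceSurfaceSaturationResidualFourGorenstein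

end
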